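import Literature.NumberTheory.LFunctions.TruncatedWeilFormTestFunctionProofs
import HarnessLib

/-!
# RH-FREE — «nothing here bears on the truth of RH»: the finite source quotient of Groskin's Guinand–Weil dictionary (arXiv:2607.02828, Lemma 2.3 (measure form) and Corollary 2.4), typed AS PRINTED and PROVED

Topic `Literature/NumberTheory/LFunctions` (namespace `Literature.NumberTheory.LFunctions.Groskin2026`, as the
statement file `TruncatedWeilFormTailOrder.lean`). STATEMENT + PROOF LAYER (D-0014), cell `rh-columns/lit`,
tranche 1 (unit `rh-lit-frontier-1`, gen 2): the last §2 items of [Gr26] that were not yet in the tree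
(companion of `TruncatedWeilFormFiniteDictionary.lean`, whose status note still lists "Corollary 2.4 … and
the measure form of Lemma 2.3" as NOT typed — superseded by this file). No named facts: both printed
statements are PROVED here (net debt 0). Source:

* **[Gr26]** A. Groskin, *A finite Guinand–Weil dictionary and archimedean tail order for the truncated
  Weil quadratic form*, arXiv:2607.02828v3 (14 Aug 2026), UNREFEREED (D-0012; a kernel proof verifies the
  finite identities below, it asserts nothing on authority). Held: `paper:arxiv-2607.02828`, p. 5–6.

## What the source prints (p. 5–6)

**Lemma 2.3 (Finite source calculus), second clause.** "Consequently, if `μ` is a finite signed Borel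
measure on `[0,1]` and `ψ_μ(x) = (1/π) ∫_{[0,1]} sin(2πωx) dμ(ω)`, then `⟨v, Q_μ v⟩ = ∫_{[0,1]} K_v(ω) dμ(ω)`."
Proof (p. 5): "For a finite signed measure, each single-frequency entry is continuous and bounded on
`[0,1]`; on the diagonal, `ψ_μ′(x) = 2 ∫_{[0,1]} ω cos(2πωx) dμ(ω)`. The finite double sum may therefore be
interchanged with the source integral."

**Corollary 2.4 (Finite source quotient).** "At level `N`, the finite source-to-form map `μ ↦ Q_μ` factors
exactly through the `2N + 1` coordinates `∫ ω dμ`, `∫ sin(2πkω) dμ`, `∫ ω cos(2πkω) dμ` (`1 ≤ k ≤ N`), and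
the induced map on these coordinates is injective: two finite signed sources produce the same level-`N`
matrix if and only if all `2N + 1` coordinates agree." Proof (p. 6): "… Inspecting the entries `(0,0)`,
`(k,0)`, and `(k,k)` recovers the displayed coordinates, so the quotient is exact in both directions."

## Lean rendering

* A finite signed Borel measure `μ` on `[0,1]` is Mathlib's `MeasureTheory.SignedMeasure ℝ` read on
  `[0,1]` through its Jordan decomposition `μ = μ⁺ − μ⁻` (`SignedMeasure.toJordanDecomposition`, two finite
  measures): `signedIntegral μ f := ∫_{[0,1]} f dμ⁺ − ∫_{[0,1]} f dμ⁻` (`= ∫_{[0,1]} f dμ`). The source is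
  `measureSource μ x = (1/π)·signedIntegral μ (ω ↦ sin(2πωx))` and `Q_μ = dividedDiffMatrix (measureSource μ) N`
  (the statement file's divided-difference matrix, diagonal `= deriv`). `K_v = volterraKernel N v`
  (complex-valued in the tree; it is real, `K_v(ω) = ⟨v, Q_{1,ω} v⟩` by `lemma_2_3_holds` /
  `volterraKernel_eq_quadValue`, and the printed `∫ K_v dμ` is `signedIntegral μ (ω ↦ Re K_v(ω))`).
* Cor. 2.4 is typed as its last sentence: `Q_μ = Q_ν ↔` (the `2N + 1` coordinates of `μ` and `ν` agree).

## Proved here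

`hasDerivAt_measureSource` / `deriv_measureSource` ("`ψ_μ′(x) = 2∫ ω cos(2πωx) dμ(ω)`", differentiation
under the integral sign against each Jordan part, `hasDerivAt_integral_of_dominated_loc_of_deriv_le` with
the bound `2π|ω|`), `dividedDiffMatrix_measureSource_apply` (the entries of `Q_μ`),
`dividedDiffMatrix_measureSource_apply_eq_signedIntegral` ("each single-frequency entry … interchanged with
the source integral"), **`lemma_2_3_measure`** (Lemma 2.3, measure form), `signedIntegral_sin_intCast` /
`signedIntegral_mul_cos_intCast` (parity in the frequency), **`corollary_2_4`** (both directions, by the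
printed inspection of the entries `(0,0)`, `(k,0)`, `(k,k)`); linearity bookkeeping for `signedIntegral`
(`_const_mul`, `_neg`, `_zero`, `_add`, `_sub`, `_finset_sum`, `_congr`; continuity hypotheses supply
integrability on `[0,1]` against the finite Jordan parts); presentation independence of the encoding
(`signedIntegral_toSignedMeasure_sub`: `∫_{[0,1]} f d(ν₁ − ν₂) = ∫ f dν₁ − ∫ f dν₂` for ANY finite `ν₁, ν₂`,
not only the Jordan parts; `signedIntegral_toSignedMeasure`); and the prime source (1) as a signed source
("whose measure places mass `−Λ(q)/√q` at `ω_q = 1 − log q/L`", proof of Thm. 2.5, p. 6): `primeAtoms`,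
`primeSigned`, `signedIntegral_primeSigned`, **`primeSource_eq_measureSource`**,
`primeMatrix_eq_dividedDiffMatrix_measureSource`, `quadValue_primeMatrix_eq_signedIntegral`.

## Status note (one paragraph, no endorsement)

[Gr26] is an unrefereed arXiv preprint (v3, 14 Aug 2026). Lemma 2.3 (single-frequency form) was proved in
the tree by this unit's first pass (`lemma_2_3_holds`); its measure form and Corollary 2.4 are finite
bookkeeping over it and are kernel theorems here, for arbitrary finite signed measures on `ℝ` integrated
over `[0,1]` (which is the printed "finite signed Borel measure on `[0,1]`"). With
`TruncatedWeilFormFiniteDictionary.lean` (Lemma 2.1 clause 2, Cor. 2.7) every statement of [Gr26] §2 is now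
typed; the §2 claims still open in the tree are `lemma_2_1_arch`, `theorem_2_5`, `theorem_2_5'` and the
`g_v ≠ 0` / injectivity clauses of `corollary_2_7`. Nothing here bears on Weil positivity or on the truth
of RH.
-/

noncomputable section

open Filter Set MeasureTheory Finset Matrix
open scoped Real Topology

namespace Literature.NumberTheory.LFunctions

namespace Groskin2026

/-! ## Lemma 2.3 (measure form) and Corollary 2.4 (finite source quotient) -/

/-- `∫_{[0,1]} f dμ` for a finite signed Borel measure `μ` read on `[0,1]`, through the Jordan decomposition
`μ = μ⁺ − μ⁻` ([Gr26] Lemma 2.3: "a finite signed Borel measure on `[0,1]`").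
[cite: Groskin2026, Lemma 2.3 (p. 5)] -/
def signedIntegral (μ : SignedMeasure ℝ) (f : ℝ → ℝ) : ℝ :=
  (∫ ω in Icc (0 : ℝ) 1, f ω ∂μ.toJordanDecomposition.posPart) -
    ∫ ω in Icc (0 : ℝ) 1, f ω ∂μ.toJordanDecomposition.negPart

/-- The source of a finite signed measure: `ψ_μ(x) = (1/π) ∫_{[0,1]} sin(2πωx) dμ(ω)` ([Gr26] Lemma 2.3).
[cite: Groskin2026, Lemma 2.3 (p. 5)] -/
def measureSource (μ : SignedMeasure ℝ) (x : ℝ) : ℝ :=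
  1 / π * signedIntegral μ (fun ω ↦ Real.sin (2 * π * ω * x))

section SignedIntegral

variable (μ : SignedMeasure ℝ)

/-- `∫ a·f dμ = a ∫ f dμ`. [cite: Groskin2026, Lemma 2.3, proof (p. 5)] -/
theorem signedIntegral_const_mul (a : ℝ) (f : ℝ → ℝ) :
    signedIntegral μ (fun ω ↦ a * f ω) = a * signedIntegral μ f := by
  simp only [signedIntegral, integral_const_mul, mul_sub]

/-- `∫ (−f) dμ = −∫ f dμ`. [cite: Groskin2026, Lemma 2.3, proof (p. 5)] -/
theorem signedIntegral_neg (f : ℝ → ℝ) :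
    signedIntegral μ (fun ω ↦ -f ω) = -signedIntegral μ f := by
  simp only [signedIntegral, integral_neg]; ring

/-- `∫ 0 dμ = 0`. [cite: Groskin2026, Lemma 2.3, proof (p. 5)] -/
theorem signedIntegral_zero : signedIntegral μ (fun _ ↦ 0) = 0 := by
  simp [signedIntegral]

/-- A continuous function is integrable on `[0,1]` against a finite measure. [folklore] -/
private theorem integrableOn_of_continuous {f : ℝ → ℝ} (hf : Continuous f) (ν : Measure ℝ)
    [IsFiniteMeasure ν] : IntegrableOn f (Icc (0 : ℝ) 1) ν :=
  hf.continuousOn.integrableOn_compact isCompact_Icc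

/-- Additivity of `∫_{[0,1]} · dμ` on continuous integrands. [cite: Groskin2026, Lemma 2.3, proof (p. 5)] -/
theorem signedIntegral_add {f g : ℝ → ℝ} (hf : Continuous f) (hg : Continuous g) :
    signedIntegral μ (fun ω ↦ f ω + g ω) = signedIntegral μ f + signedIntegral μ g := by
  simp only [signedIntegral]
  rw [integral_add (integrableOn_of_continuous hf _) (integrableOn_of_continuous hg _),
    integral_add (integrableOn_of_continuous hf _) (integrableOn_of_continuous hg _)]
  ring

/-- `∫ (f − g) dμ = ∫ f dμ − ∫ g dμ` on continuous integrands. [cite: Groskin2026, Lemma 2.3, proof (p. 5)] -/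
theorem signedIntegral_sub {f g : ℝ → ℝ} (hf : Continuous f) (hg : Continuous g) :
    signedIntegral μ (fun ω ↦ f ω - g ω) = signedIntegral μ f - signedIntegral μ g := by
  simp only [signedIntegral]
  rw [integral_sub (integrableOn_of_continuous hf _) (integrableOn_of_continuous hg _),
    integral_sub (integrableOn_of_continuous hf _) (integrableOn_of_continuous hg _)]
  ring

/-- "The finite double sum may therefore be interchanged with the source integral" (p. 5): finite sums of
continuous integrands. [cite: Groskin2026, Lemma 2.3, proof (p. 5)] -/
theorem signedIntegral_finset_sum {ι : Type*} (s : Finset ι) (f : ι → ℝ → ℝ)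
    (hf : ∀ i ∈ s, Continuous (f i)) :
    signedIntegral μ (fun ω ↦ ∑ i ∈ s, f i ω) = ∑ i ∈ s, signedIntegral μ (f i) := by
  simp only [signedIntegral]
  rw [integral_finsetSum s fun i hi ↦ integrableOn_of_continuous (hf i hi) _,
    integral_finsetSum s fun i hi ↦ integrableOn_of_continuous (hf i hi) _, Finset.sum_sub_distrib]

/-- Congruence of `∫_{[0,1]} · dμ` in the integrand. [cite: Groskin2026, Lemma 2.3 (p. 5)] -/
theorem signedIntegral_congr {f g : ℝ → ℝ} (h : ∀ ω, f ω = g ω) :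
    signedIntegral μ f = signedIntegral μ g := by
  rw [show f = g from funext h]

/-- Differentiation under the integral sign against one (finite) Jordan part:
`d/dx ∫_{[0,1]} sin(2πωx) dν(ω) = ∫_{[0,1]} 2πω cos(2πωx) dν(ω)` (dominated by `2π|ω|`).
[cite: Groskin2026, Lemma 2.3, proof (p. 5)] -/
theorem hasDerivAt_setIntegral_sin (ν : Measure ℝ) [IsFiniteMeasure ν] (x₀ : ℝ) :
    HasDerivAt (fun x ↦ ∫ ω in Icc (0 : ℝ) 1, Real.sin (2 * π * ω * x) ∂ν)
      (∫ ω in Icc (0 : ℝ) 1, 2 * π * ω * Real.cos (2 * π * ω * x₀) ∂ν) x₀ := by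
  have hdiff : ∀ ω x : ℝ, HasDerivAt (fun x ↦ Real.sin (2 * π * ω * x))
      (2 * π * ω * Real.cos (2 * π * ω * x)) x := by
    intro ω x
    have h1 : HasDerivAt (fun x : ℝ ↦ 2 * π * ω * x) (2 * π * ω) x := by
      simpa using (hasDerivAt_id x).const_mul (2 * π * ω)
    exact ((Real.hasDerivAt_sin _).comp x h1).congr_deriv (by ring)
  have h := hasDerivAt_integral_of_dominated_loc_of_deriv_le (μ := ν.restrict (Icc (0 : ℝ) 1))
    (F := fun x ω ↦ Real.sin (2 * π * ω * x)) (F' := fun x ω ↦ 2 * π * ω * Real.cos (2 * π * ω * x))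
    (x₀ := x₀) (bound := fun ω ↦ 2 * π * |ω|) (s := univ) Filter.univ_mem
    (Filter.Eventually.of_forall fun x ↦ (by fun_prop : Continuous fun ω : ℝ ↦
      Real.sin (2 * π * ω * x)).aestronglyMeasurable)
    (integrableOn_of_continuous (by fun_prop) ν)
    ((by fun_prop : Continuous fun ω : ℝ ↦ 2 * π * ω * Real.cos (2 * π * ω * x₀)).aestronglyMeasurable)
    (Filter.Eventually.of_forall fun ω x _ ↦ by
      calc ‖2 * π * ω * Real.cos (2 * π * ω * x)‖ = 2 * π * |ω| * |Real.cos (2 * π * ω * x)| := by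
            rw [Real.norm_eq_abs, abs_mul, abs_mul, abs_of_pos Real.two_pi_pos]
        _ ≤ 2 * π * |ω| * 1 := by gcongr; exact Real.abs_cos_le_one _
        _ = 2 * π * |ω| := mul_one _)
    (integrableOn_of_continuous (by fun_prop) ν)
    (Filter.Eventually.of_forall fun ω x _ ↦ hdiff ω x)
  exact h.2

/-- "on the diagonal, `ψ_μ′(x) = 2 ∫_{[0,1]} ω cos(2πωx) dμ(ω)`" (p. 5). PROVED.
[cite: Groskin2026, Lemma 2.3, proof (p. 5)] -/
theorem hasDerivAt_measureSource (x : ℝ) :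
    HasDerivAt (measureSource μ)
      (2 * signedIntegral μ (fun ω ↦ ω * Real.cos (2 * π * ω * x))) x := by
  have hp := hasDerivAt_setIntegral_sin μ.toJordanDecomposition.posPart x
  have hn := hasDerivAt_setIntegral_sin μ.toJordanDecomposition.negPart x
  have h := (hp.sub hn).const_mul (1 / π)
  have hfun : measureSource μ = fun x ↦ 1 / π *
      ((∫ ω in Icc (0 : ℝ) 1, Real.sin (2 * π * ω * x) ∂μ.toJordanDecomposition.posPart) -
        ∫ ω in Icc (0 : ℝ) 1, Real.sin (2 * π * ω * x) ∂μ.toJordanDecomposition.negPart) := by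
    funext x; simp only [measureSource, signedIntegral]
  rw [hfun]
  refine h.congr_deriv ?_
  rw [signedIntegral]
  have e : ∀ (ν : Measure ℝ), (∫ ω in Icc (0 : ℝ) 1, 2 * π * ω * Real.cos (2 * π * ω * x) ∂ν) =
      2 * π * ∫ ω in Icc (0 : ℝ) 1, ω * Real.cos (2 * π * ω * x) ∂ν := by
    intro ν
    rw [← integral_const_mul]
    exact integral_congr_ae (Filter.Eventually.of_forall fun ω ↦ by ring)
  rw [e, e, ← mul_sub, ← mul_assoc]
  congr 1
  have hπ : (π : ℝ) ≠ 0 := Real.pi_ne_zero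
  field_simp

/-- `deriv` form of `hasDerivAt_measureSource`. [cite: Groskin2026, Lemma 2.3, proof (p. 5)] -/
theorem deriv_measureSource (x : ℝ) :
    deriv (measureSource μ) x = 2 * signedIntegral μ (fun ω ↦ ω * Real.cos (2 * π * ω * x)) :=
  (hasDerivAt_measureSource μ x).deriv

/-- The entries of `Q_μ`: `(ψ_μ(m) − ψ_μ(n))/(m − n)` off the diagonal, `ψ_μ′(m) = 2∫ ω cos(2πωm) dμ` on it.
[cite: Groskin2026, Lemma 2.3 (p. 5)] -/
theorem dividedDiffMatrix_measureSource_apply (N : ℕ) (m n : idx N) :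
    dividedDiffMatrix (measureSource μ) N m n =
      if (m : ℤ) = n then 2 * signedIntegral μ (fun ω ↦ ω * Real.cos (2 * π * ω * ((m : ℤ) : ℝ)))
      else 1 / π * (signedIntegral μ (fun ω ↦ Real.sin (2 * π * ω * ((m : ℤ) : ℝ))) -
          signedIntegral μ (fun ω ↦ Real.sin (2 * π * ω * ((n : ℤ) : ℝ)))) /
        (((m : ℤ) : ℝ) - ((n : ℤ) : ℝ)) := by
  unfold dividedDiffMatrix
  rw [Matrix.of_apply]
  split_ifs with h
  · exact deriv_measureSource μ _
  · simp only [measureSource]; ring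

/-- "each single-frequency entry is continuous and bounded on `[0,1]`": every entry of `Q_μ` is the
`μ`-integral of the corresponding entry of the single-frequency matrix `Q_{1,ω}`.
[cite: Groskin2026, Lemma 2.3, proof (p. 5)] -/
theorem dividedDiffMatrix_measureSource_apply_eq_signedIntegral (N : ℕ) (m n : idx N) :
    dividedDiffMatrix (measureSource μ) N m n =
      signedIntegral μ (fun ω ↦
        dividedDiffMatrix (fun x ↦ 1 / π * Real.sin (2 * π * ω * x)) N m n) := by
  rw [dividedDiffMatrix_measureSource_apply]
  simp only [dividedDiffMatrix_singleFreq_apply]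
  split_ifs with h
  · rw [← signedIntegral_const_mul]
    exact signedIntegral_congr μ fun ω ↦ by ring
  · symm
    rw [signedIntegral_congr μ (g := fun ω ↦ (1 / π / (((m : ℤ) : ℝ) - ((n : ℤ) : ℝ))) *
        (Real.sin (2 * π * ω * ((m : ℤ) : ℝ)) - Real.sin (2 * π * ω * ((n : ℤ) : ℝ)))) (fun ω ↦ by ring),
      signedIntegral_const_mul, signedIntegral_sub μ (by fun_prop) (by fun_prop)]
    ring

/-- **[Gr26] Lemma 2.3, second clause (measure form) — PROVED:** for every finite signed Borel measure `μ`
read on `[0,1]`, `⟨v, Q_μ v⟩ = ∫_{[0,1]} K_v(ω) dμ(ω)` (with `K_v` real: `Re K_v = ⟨v, Q_{1,ω} v⟩`,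
`volterraKernel_eq_quadValue`). [cite: Groskin2026, Lemma 2.3 (p. 5)] -/
theorem lemma_2_3_measure (N : ℕ) (v : Fin (N + 1) → ℝ) (μ : SignedMeasure ℝ) :
    quadValue N v (dividedDiffMatrix (measureSource μ) N) =
      signedIntegral μ (fun ω ↦ (volterraKernel N v ω).re) := by
  have hK : ∀ ω, (volterraKernel N v ω).re =
      ∑ m : idx N, ∑ n : idx N, evenEmbed N v m * evenEmbed N v n *
        dividedDiffMatrix (fun x ↦ 1 / π * Real.sin (2 * π * ω * x)) N m n := by
    intro ω
    rw [volterraKernel_eq_quadValue, Complex.ofReal_re, quadValue_eq_sum']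
  rw [signedIntegral_congr μ hK, quadValue_eq_sum']
  have hcont : ∀ (m n : idx N), Continuous fun ω : ℝ ↦
      dividedDiffMatrix (fun x ↦ 1 / π * Real.sin (2 * π * ω * x)) N m n := by
    intro m n
    simp only [dividedDiffMatrix_singleFreq_apply]
    split_ifs <;> fun_prop
  rw [signedIntegral_finset_sum μ _ _ fun m _ ↦ (by fun_prop)]
  refine Finset.sum_congr rfl fun m _ ↦ ?_
  rw [signedIntegral_finset_sum μ _ _ fun n _ ↦ (by fun_prop)]
  refine Finset.sum_congr rfl fun n _ ↦ ?_
  rw [signedIntegral_const_mul, dividedDiffMatrix_measureSource_apply_eq_signedIntegral]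

end SignedIntegral

/-! ### Corollary 2.4 -/

/-- `0 ∈ I_N`. [cite: Groskin2026, §2.1 (p. 3)] -/
private theorem zero_mem_idx' (N : ℕ) : (0 : ℤ) ∈ idx N := by simp [idx]
/-- `k ∈ I_N` for `k ≤ N`. [cite: Groskin2026, §2.1 (p. 3)] -/
private theorem nat_mem_idx {N k : ℕ} (hk : k ≤ N) : (k : ℤ) ∈ idx N := by
  simp only [idx, Finset.mem_Icc]; omega

/-- Parity in the frequency: `∫ sin(2πωm) dμ = sign(m) ∫ sin(2π|m|ω) dμ` (so the off-diagonal entries of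
`Q_μ` only see the coordinates `∫ sin(2πkω) dμ`, `1 ≤ k ≤ N`). [cite: Groskin2026, Corollary 2.4, proof (p. 6)] -/
theorem signedIntegral_sin_intCast (μ : SignedMeasure ℝ) (m : ℤ) :
    signedIntegral μ (fun ω ↦ Real.sin (2 * π * ω * m)) =
      (Int.sign m : ℝ) * signedIntegral μ (fun ω ↦ Real.sin (2 * π * (m.natAbs : ℕ) * ω)) := by
  rcases eq_or_ne m 0 with h0 | h0
  · subst h0
    simp [signedIntegral]
  have hpos : 0 < m.natAbs := Int.natAbs_pos.mpr h0
  rcases Int.natAbs_eq m with h | h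
  · have hm : ((m : ℤ) : ℝ) = ((m.natAbs : ℕ) : ℝ) := by
      rw [← Int.cast_natCast (R := ℝ) m.natAbs, ← h]
    have hs : Int.sign m = 1 := Int.sign_eq_one_of_pos (by rw [h]; exact_mod_cast hpos)
    rw [hs]
    push_cast
    rw [one_mul]
    exact signedIntegral_congr μ fun ω ↦ by rw [hm]; ring_nf
  · have hm : ((m : ℤ) : ℝ) = -((m.natAbs : ℕ) : ℝ) := by
      rw [← Int.cast_natCast (R := ℝ) m.natAbs, ← Int.cast_neg, ← h]
    have hs : Int.sign m = -1 :=
      Int.sign_eq_neg_one_of_neg (by rw [h]; exact neg_lt_zero.mpr (by exact_mod_cast hpos))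
    rw [hs]
    push_cast
    rw [neg_one_mul, ← signedIntegral_neg]
    exact signedIntegral_congr μ fun ω ↦ by rw [hm, ← Real.sin_neg]; ring_nf

/-- Parity in the frequency: `∫ ω cos(2πωm) dμ = ∫ ω cos(2π|m|ω) dμ` (so the diagonal of `Q_μ` only sees
`∫ ω dμ` and `∫ ω cos(2πkω) dμ`, `1 ≤ k ≤ N`). [cite: Groskin2026, Corollary 2.4, proof (p. 6)] -/
theorem signedIntegral_mul_cos_intCast (μ : SignedMeasure ℝ) (m : ℤ) :
    signedIntegral μ (fun ω ↦ ω * Real.cos (2 * π * ω * m)) =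
      signedIntegral μ (fun ω ↦ ω * Real.cos (2 * π * (m.natAbs : ℕ) * ω)) := by
  rcases Int.natAbs_eq m with h | h
  · have hm : ((m : ℤ) : ℝ) = ((m.natAbs : ℕ) : ℝ) := by
      rw [← Int.cast_natCast (R := ℝ) m.natAbs, ← h]
    exact signedIntegral_congr μ fun ω ↦ by rw [hm]; ring_nf
  · have hm : ((m : ℤ) : ℝ) = -((m.natAbs : ℕ) : ℝ) := by
      rw [← Int.cast_natCast (R := ℝ) m.natAbs, ← Int.cast_neg, ← h]
    exact signedIntegral_congr μ fun ω ↦ by rw [hm, ← Real.cos_neg]; ring_nf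

/-- **[Gr26] Corollary 2.4 (finite source quotient) — PROVED, AS PRINTED** ("two finite signed sources
produce the same level-`N` matrix if and only if all `2N + 1` coordinates agree": the map `μ ↦ Q_μ` factors
exactly through `∫ ω dμ`, `∫ sin(2πkω) dμ`, `∫ ω cos(2πkω) dμ` (`1 ≤ k ≤ N`) and is injective on them). Proof
as printed: the entries are functions of the coordinates (parity in the frequency), and the entries
`(0,0)`, `(k,0)`, `(k,k)` recover them. [cite: Groskin2026, Corollary 2.4 (p. 5–6)] -/
theorem corollary_2_4 (N : ℕ) (μ ν : SignedMeasure ℝ) :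
    dividedDiffMatrix (measureSource μ) N = dividedDiffMatrix (measureSource ν) N ↔
      (signedIntegral μ (fun ω ↦ ω) = signedIntegral ν (fun ω ↦ ω) ∧
        ∀ k : ℕ, 1 ≤ k → k ≤ N →
          signedIntegral μ (fun ω ↦ Real.sin (2 * π * k * ω)) =
              signedIntegral ν (fun ω ↦ Real.sin (2 * π * k * ω)) ∧
            signedIntegral μ (fun ω ↦ ω * Real.cos (2 * π * k * ω)) =
              signedIntegral ν (fun ω ↦ ω * Real.cos (2 * π * k * ω))) := by
  constructor
  · intro H
    have He : ∀ m n : idx N, dividedDiffMatrix (measureSource μ) N m n =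
        dividedDiffMatrix (measureSource ν) N m n := fun m n ↦ by rw [H]
    refine ⟨?_, fun k hk1 hkN ↦ ⟨?_, ?_⟩⟩
    · -- entry (0,0)
      have h := He ⟨0, zero_mem_idx' N⟩ ⟨0, zero_mem_idx' N⟩
      rw [dividedDiffMatrix_measureSource_apply, dividedDiffMatrix_measureSource_apply, if_pos rfl,
        if_pos rfl] at h
      push_cast at h
      simp only [mul_zero, Real.cos_zero, mul_one] at h
      linarith
    · -- entry (k,0)
      have h := He ⟨k, nat_mem_idx hkN⟩ ⟨0, zero_mem_idx' N⟩
      have hk0 : ((k : ℤ)) ≠ 0 := by omega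
      rw [dividedDiffMatrix_measureSource_apply, dividedDiffMatrix_measureSource_apply, if_neg hk0,
        if_neg hk0] at h
      push_cast at h
      simp only [mul_zero, Real.sin_zero, sub_zero] at h
      have hπ : (π : ℝ) ≠ 0 := Real.pi_ne_zero
      have hk : (k : ℝ) ≠ 0 := by exact_mod_cast (show k ≠ 0 by omega)
      rw [signedIntegral_zero, signedIntegral_zero, sub_zero, sub_zero, mul_div_assoc,
        mul_div_assoc] at h
      have h' := mul_left_cancel₀ (one_div_ne_zero hπ) h
      rw [div_left_inj' hk] at h'
      have e : ∀ ρ : SignedMeasure ℝ, signedIntegral ρ (fun ω ↦ Real.sin (2 * π * ω * k)) =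
          signedIntegral ρ (fun ω ↦ Real.sin (2 * π * k * ω)) :=
        fun ρ ↦ signedIntegral_congr ρ fun ω ↦ by ring_nf
      rw [← e, ← e]
      exact h'
    · -- entry (k,k)
      have h := He ⟨k, nat_mem_idx hkN⟩ ⟨k, nat_mem_idx hkN⟩
      rw [dividedDiffMatrix_measureSource_apply, dividedDiffMatrix_measureSource_apply, if_pos rfl,
        if_pos rfl] at h
      push_cast at h
      have e : ∀ ρ : SignedMeasure ℝ, signedIntegral ρ (fun ω ↦ ω * Real.cos (2 * π * ω * k)) =
          signedIntegral ρ (fun ω ↦ ω * Real.cos (2 * π * k * ω)) :=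
        fun ρ ↦ signedIntegral_congr ρ fun ω ↦ by ring_nf
      rw [← e, ← e]
      linarith
  · rintro ⟨h0, hk⟩
    -- the values `S(m) = ∫ sin(2πωm)` and `C(m) = ∫ ω cos(2πωm)` agree for every `m ∈ I_N`
    have hS : ∀ m : idx N, signedIntegral μ (fun ω ↦ Real.sin (2 * π * ω * ((m : ℤ) : ℝ))) =
        signedIntegral ν (fun ω ↦ Real.sin (2 * π * ω * ((m : ℤ) : ℝ))) := by
      intro m
      rw [signedIntegral_sin_intCast, signedIntegral_sin_intCast]
      rcases Nat.eq_zero_or_pos (m : ℤ).natAbs with h | h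
      · have : (m : ℤ) = 0 := Int.natAbs_eq_zero.mp h
        simp [this]
      · rw [(hk _ h (natAbs_le_of_mem_idx m.2)).1]
    have hC : ∀ m : idx N, signedIntegral μ (fun ω ↦ ω * Real.cos (2 * π * ω * ((m : ℤ) : ℝ))) =
        signedIntegral ν (fun ω ↦ ω * Real.cos (2 * π * ω * ((m : ℤ) : ℝ))) := by
      intro m
      rw [signedIntegral_mul_cos_intCast, signedIntegral_mul_cos_intCast]
      rcases Nat.eq_zero_or_pos (m : ℤ).natAbs with h | h
      · rw [h]; push_cast; simpa using h0
      · exact (hk _ h (natAbs_le_of_mem_idx m.2)).2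
    ext m n
    rw [dividedDiffMatrix_measureSource_apply, dividedDiffMatrix_measureSource_apply]
    split_ifs
    · rw [hC]
    · rw [hS, hS]

/-! ### The encoding is presentation-independent; the prime source as a signed source -/

/-- The encoding `signedIntegral` does not depend on the Jordan decomposition: for ANY presentation
`μ = ν₁ − ν₂` by finite measures, `∫_{[0,1]} f dμ = ∫_{[0,1]} f dν₁ − ∫_{[0,1]} f dν₂` (continuous `f`;
uniqueness `μ⁺ + ν₂ = ν₁ + μ⁻` of the difference). [cite: Groskin2026, Lemma 2.3 (p. 5)] -/
theorem signedIntegral_toSignedMeasure_sub (ν₁ ν₂ : Measure ℝ) [IsFiniteMeasure ν₁] [IsFiniteMeasure ν₂]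
    {f : ℝ → ℝ} (hf : Continuous f) :
    signedIntegral (ν₁.toSignedMeasure - ν₂.toSignedMeasure) f =
      (∫ ω in Icc (0 : ℝ) 1, f ω ∂ν₁) - ∫ ω in Icc (0 : ℝ) 1, f ω ∂ν₂ := by
  set μ := ν₁.toSignedMeasure - ν₂.toSignedMeasure with hμ
  set j := μ.toJordanDecomposition with hj
  -- `j.posPart - j.negPart = ν₁ - ν₂` as signed measures, hence `j.posPart + ν₂ = ν₁ + j.negPart`
  have h1 : j.posPart.toSignedMeasure - j.negPart.toSignedMeasure = μ := by
    rw [← JordanDecomposition.toSignedMeasure, hj, SignedMeasure.toSignedMeasure_toJordanDecomposition]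
  have h2 : (j.posPart + ν₂).toSignedMeasure = (ν₁ + j.negPart).toSignedMeasure := by
    rw [Measure.toSignedMeasure_add, Measure.toSignedMeasure_add]
    rw [hμ] at h1
    exact sub_eq_sub_iff_add_eq_add.mp h1
  have h3 : j.posPart + ν₂ = ν₁ + j.negPart := (Measure.toSignedMeasure_eq_toSignedMeasure_iff).mp h2
  have hint : ∀ (ν : Measure ℝ) [IsFiniteMeasure ν], IntegrableOn f (Icc (0 : ℝ) 1) ν :=
    fun ν _ ↦ hf.continuousOn.integrableOn_compact isCompact_Icc
  have h4 : (∫ ω in Icc (0 : ℝ) 1, f ω ∂j.posPart) + ∫ ω in Icc (0 : ℝ) 1, f ω ∂ν₂ =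
      (∫ ω in Icc (0 : ℝ) 1, f ω ∂ν₁) + ∫ ω in Icc (0 : ℝ) 1, f ω ∂j.negPart := by
    rw [← integral_add_measure (hint _) (hint _), ← integral_add_measure (hint _) (hint _),
      ← Measure.restrict_add, ← Measure.restrict_add, h3]
  rw [signedIntegral]
  linarith

/-- In particular for a (finite, positive) measure `ν` viewed as a signed measure, `signedIntegral` is the
ordinary integral over `[0,1]`. [cite: Groskin2026, Lemma 2.3 (p. 5)] -/
theorem signedIntegral_toSignedMeasure (ν : Measure ℝ) [IsFiniteMeasure ν] {f : ℝ → ℝ}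
    (hf : Continuous f) :
    signedIntegral ν.toSignedMeasure f = ∫ ω in Icc (0 : ℝ) 1, f ω ∂ν := by
  have h := signedIntegral_toSignedMeasure_sub ν 0 hf
  simp only [Measure.toSignedMeasure_zero, sub_zero, Measure.restrict_zero, integral_zero_measure] at h
  exact h

/-- The (positive, finite, atomic) measure `Σ_{q ≤ ⌊c⌋} (Λ(q)/√q) δ_{ω_q}`, `ω_q = 1 − log q/L`, whose
NEGATIVE is the measure of the prime source (1) ([Gr26] proof of Thm. 2.5, p. 6: "the prime source (1),
whose measure places mass `−Λ(q)/√q` at `ω_q = 1 − log q/L`"). [cite: Groskin2026, Theorem 2.5, proof (p. 6)] -/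
def primeAtoms (c : ℝ) : Measure ℝ :=
  ∑ q ∈ Finset.range (⌊c⌋₊ + 1),
    ENNReal.ofReal (ArithmeticFunction.vonMangoldt q / Real.sqrt q) •
      Measure.dirac (1 - Real.log q / Real.log c)

/-- The atomic measure is finite (a theorem, not an instance). [cite: Groskin2026, Theorem 2.5, proof (p. 6)] -/
theorem isFiniteMeasure_primeAtoms (c : ℝ) : IsFiniteMeasure (primeAtoms c) := by
  refine ⟨?_⟩
  rw [primeAtoms, Measure.coe_finsetSum, Finset.sum_apply]
  refine ENNReal.sum_lt_top.mpr fun q _ ↦ ?_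
  rw [Measure.smul_apply, smul_eq_mul]
  exact ENNReal.mul_lt_top ENNReal.ofReal_lt_top (measure_lt_top _ _)

/-- Every function is integrable against a Dirac mass on `ℝ`. [folklore] -/
private theorem integrable_dirac_real' (g : ℝ → ℝ) (a : ℝ) : Integrable g (Measure.dirac a) :=
  (integrable_const (g a)).congr (ae_eq_dirac g).symm

/-- `∫ f d(Σ_q (Λ(q)/√q) δ_{ω_q}) = Σ_q (Λ(q)/√q) f(ω_q)`. [cite: Groskin2026, Theorem 2.5, proof (p. 6)] -/
theorem integral_primeAtoms (c : ℝ) (f : ℝ → ℝ) :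
    ∫ ω, f ω ∂primeAtoms c =
      ∑ q ∈ Finset.range (⌊c⌋₊ + 1),
        ArithmeticFunction.vonMangoldt q / Real.sqrt q * f (1 - Real.log q / Real.log c) := by
  unfold primeAtoms
  rw [integral_finsetSum_measure]
  · refine Finset.sum_congr rfl fun q _ ↦ ?_
    rw [integral_smul_measure, integral_dirac, ENNReal.toReal_ofReal, smul_eq_mul]
    exact div_nonneg ArithmeticFunction.vonMangoldt_nonneg (Real.sqrt_nonneg _)
  · intro q _
    exact (integrable_dirac_real' f _).smul_measure ENNReal.ofReal_ne_top

/-- The atoms `ω_q = 1 − log q/L`, `q ≤ c`, lie in `[0,1]` (`c > 1`). [cite: Groskin2026, Theorem 2.5, proof (p. 6)] -/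
theorem primeAtoms_restrict_Icc {c : ℝ} (hc : 1 < c) :
    (primeAtoms c).restrict (Icc (0 : ℝ) 1) = primeAtoms c := by
  classical
  have hL : 0 < Real.log c := Real.log_pos hc
  unfold primeAtoms
  rw [← Measure.restrictₗ_apply, map_sum]
  refine Finset.sum_congr rfl fun q hq ↦ ?_
  rw [map_smul, Measure.restrictₗ_apply, MeasureTheory.restrict_dirac' measurableSet_Icc, if_pos]
  rw [Finset.mem_range] at hq
  have hq' : (q : ℝ) ≤ c := (Nat.cast_le.mpr (Nat.le_of_lt_succ hq)).trans (Nat.floor_le (by linarith))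
  constructor
  · have : Real.log q ≤ Real.log c := by
      rcases Nat.eq_zero_or_pos q with h0 | hpos
      · subst h0; simp [hL.le]
      · exact Real.log_le_log (by exact_mod_cast hpos) hq'
    have := div_le_one_of_le₀ this hL.le
    linarith
  · have : 0 ≤ Real.log q := Real.log_natCast_nonneg q
    have := div_nonneg this hL.le
    linarith

/-- The prime source's finite signed measure `μ_p = −Σ_{q ≤ c} (Λ(q)/√q) δ_{ω_q}` (as a Mathlib
`SignedMeasure`; the finiteness proof is supplied explicitly, no instance is declared).
[cite: Groskin2026, Theorem 2.5, proof (p. 6)] -/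
def primeSigned (c : ℝ) : SignedMeasure ℝ :=
  -@Measure.toSignedMeasure ℝ _ (primeAtoms c) (isFiniteMeasure_primeAtoms c)

/-- `∫_{[0,1]} f dμ_p = −Σ_{q ≤ c} (Λ(q)/√q) f(ω_q)` (continuous `f`, `c > 1`): the `2N + 1` coordinates
of Cor. 2.4 for the prime source are the prime sums `−Σ_q (Λ(q)/√q) ω_q`, `−Σ_q (Λ(q)/√q) sin(2πkω_q)`,
`−Σ_q (Λ(q)/√q) ω_q cos(2πkω_q)`. [cite: Groskin2026, Theorem 2.5, proof (p. 6); Corollary 2.4 (p. 5)] -/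
theorem signedIntegral_primeSigned {c : ℝ} (hc : 1 < c) {f : ℝ → ℝ} (hf : Continuous f) :
    signedIntegral (primeSigned c) f =
      -∑ q ∈ Finset.range (⌊c⌋₊ + 1),
        ArithmeticFunction.vonMangoldt q / Real.sqrt q * f (1 - Real.log q / Real.log c) := by
  haveI := isFiniteMeasure_primeAtoms c
  rw [primeSigned, ← zero_sub, ← Measure.toSignedMeasure_zero,
    signedIntegral_toSignedMeasure_sub 0 (primeAtoms c) hf, Measure.restrict_zero,
    integral_zero_measure, zero_sub, primeAtoms_restrict_Icc hc, integral_primeAtoms]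

/-- **The prime source is a measure source — PROVED:** `ψ_p^{(c)} = ψ_{μ_p}` ("Lemma 2.3 applied to the
prime source (1), whose measure places mass `−Λ(q)/√q` at `ω_q = 1 − log q/L`", p. 6), so `Q_prime`
falls under Lemma 2.3 (measure form) and Corollary 2.4 (`primeMatrix_eq_dividedDiffMatrix_measureSource`).
[cite: Groskin2026, Theorem 2.5, proof (p. 6)] -/
theorem primeSource_eq_measureSource {c : ℝ} (hc : 1 < c) :
    primeSource c = measureSource (primeSigned c) := by
  funext x
  rw [measureSource, signedIntegral_primeSigned hc (by fun_prop), primeSource, mul_neg, ← neg_mul]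
  congr 1
  refine Finset.sum_congr rfl fun q _ ↦ ?_
  ring_nf

/-- `Q_prime^{(c)} = Q_{μ_p}`: the prime block is the matrix of a finite signed source in the sense of
Lemma 2.3 / Corollary 2.4. [cite: Groskin2026, Theorem 2.5, proof (p. 6)] -/
theorem primeMatrix_eq_dividedDiffMatrix_measureSource {c : ℝ} (hc : 1 < c) (N : ℕ) :
    primeMatrix c N = dividedDiffMatrix (measureSource (primeSigned c)) N := by
  rw [primeMatrix, primeSource_eq_measureSource hc]

/-- Hence `⟨v, Q_prime v⟩ = ∫_{[0,1]} K_v dμ_p = −Σ_{q ≤ c} (Λ(q)/√q) K_v(ω_q)` by the measure form of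
Lemma 2.3 (the first display of the proof of Thm. 2.5, p. 6, before the substitution `ĝ_v(log q/2π) =
πK_v(ω_q)`; cf. cc-t9's `quadValue_primeMatrix_eq_sum_volterraKernel`). [cite: Groskin2026, Theorem 2.5, proof (p. 6)] -/
theorem quadValue_primeMatrix_eq_signedIntegral {c : ℝ} (hc : 1 < c) (N : ℕ) (v : Fin (N + 1) → ℝ) :
    quadValue N v (primeMatrix c N) =
      -∑ q ∈ Finset.range (⌊c⌋₊ + 1), ArithmeticFunction.vonMangoldt q / Real.sqrt q *
        (volterraKernel N v (1 - Real.log q / Real.log c)).re := by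
  rw [primeMatrix_eq_dividedDiffMatrix_measureSource hc, lemma_2_3_measure,
    signedIntegral_primeSigned hc]
  exact Complex.continuous_re.comp (continuous_volterraKernel N v)

end Groskin2026

end Literature.NumberTheory.LFunctions

end
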